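import Literature.Probability.RandomPlanarGeometry.SAWHookWalks
import Literature.Probability.RandomPlanarGeometry.SAWHalfSpacePiecesSymmetry
import Literature.Probability.RandomPlanarGeometry.SAWPolygonGrowth
import HarnessLib

/-!
# Lower envelope `e^{-c√N} μ^N ≤ c_N(0,x)` for every fixed `x ≠ 0` in `ℤ^d`, `d ≥ 2` (Madras–Slade (3.2.11) / Corollary 3.2.6)

Topic `Literature/Probability/RandomPlanarGeometry` (continues `SAWHookWalks.lean`: the explicit long walk with an insertion site;
`SAWEndpointPieceInsertionZd.lean`: `PieceInsertionZd.card_core_mul_card_pieces_le`; `SAWHalfSpacePiecesSymmetry.lean`: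
`HalfSpacePieces.countAt_le_card_halfSpace`; `SAWPolygonGrowth.lean`: Corollary 3.2.5 in every dimension,
`Zd.MadrasSlade1993_cor325_lower_general`; general-`d` twin of `SAWEndpointLowerEnvelope.lean`).

Source: N. Madras, G. Slade, *The Self-Avoiding Walk* (1993), Corollary 3.2.6 (book p. 68) and its proof: for fixed `z ≠ 0` in `ℤ^d`
and `N` of the parity of `‖z‖₁`, a fixed self-avoiding walk `φ : 0 → z` concatenated with the polygons of `Q_I[N − L_N]` gives
(3.2.11) `c_N(0,z) ≥ q_{N−L_N}/(d−1)`, whence with Corollary 3.2.5 `lim c_N(0,z)^{1/N} = μ` (3.2.10).  Here, with the insertion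
device of `SAWEndpointPieceInsertionZd.lean` in place of the printed concatenation, the quantitative lower envelope in every
dimension `d ≥ 2` (the tree's `ℤ²` version is `EndpointEnvelope.exists_exp_mul_pow_le_countAt`):

* **`EndpointEnvelopeZd.exists_exp_mul_pow_le_countAt`** — for every `x ≠ 0` in `ℤ^{d+2}` there are `c ≥ 0` and `N₀` with
  `e^{-c√N} μ^N ≤ c_N(0,x)` for all `N ≥ N₀` with `N ≡ ‖x‖₁ (mod 2)`;
* `MadrasSlade1993_cor326_allDim` — Corollary 3.2.6, eq. (3.2.10), AS PRINTED for a fixed endpoint: `c_N(0,x)^{1/N} → μ` along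
  the parity class of `‖x‖₁`, every `x ≠ 0`, every `d ≥ 2`.
-/

noncomputable section

open Filter Topology Finset Literature.Probability.LatticeModels SimpleGraph

namespace Literature.Probability.RandomPlanarGeometry.SAW.Zd

namespace EndpointEnvelopeZd

variable {d : ℕ}

/-- Elementary: `2N ≤ e^{2√N}` for `N ≥ 0`. [folklore] -/
private theorem two_mul_le_exp_two_sqrt {N : ℝ} (hN : 0 ≤ N) : 2 * N ≤ Real.exp (2 * Real.sqrt N) := by
  have h1 : 1 + 2 * Real.sqrt N + (2 * Real.sqrt N) ^ 2 / 2 ≤ Real.exp (2 * Real.sqrt N) := by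
    have := Real.quadratic_le_exp_of_nonneg (show 0 ≤ 2 * Real.sqrt N by positivity)
    linarith
  have h2 : (2 * Real.sqrt N) ^ 2 / 2 = 2 * N := by
    rw [mul_pow, Real.sq_sqrt hN]; ring
  have h3 : 0 ≤ Real.sqrt N := Real.sqrt_nonneg N
  linarith

/-- **Lower envelope for the fixed-endpoint counts in every dimension (Madras–Slade (3.2.11) / Corollary 3.2.6, quantitative)**:
for every `x ≠ 0` in `ℤ^{d+2}` there are `c ≥ 0` and `N₀` such that `e^{-c√N} μ^N ≤ c_N(0,x)` for all `N ≥ N₀` with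
`N ≡ ‖x‖₁ (mod 2)`. [cite: MadrasSlade1993, Corollary 3.2.6, eqs. (3.2.10)–(3.2.11) (p. 68); Corollary 3.2.5, eq. (3.2.8)] -/
theorem exists_exp_mul_pow_le_countAt (x : Site (d + 2)) (hx : x ≠ 0) :
    ∃ c : ℝ, ∃ N₀ : ℕ, 0 ≤ c ∧ ∀ N : ℕ, N₀ ≤ N → N % 2 = normOne x % 2 →
      Real.exp (-(c * Real.sqrt N)) * connectiveConstant (d + 2) ^ N ≤ (countAt (d + 2) N x : ℝ) := by
  classical
  -- an axis `k` with `x_k ≠ 0`, a second axis `k' ≠ k`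
  obtain ⟨k, hxk⟩ : ∃ k : Fin (d + 2), x k ≠ 0 := by
    by_contra h
    push Not at h
    exact hx (funext fun i => h i)
  obtain ⟨k', hkk⟩ : ∃ k' : Fin (d + 2), k' ≠ k := by
    by_cases h : k = 0
    · exact ⟨1, by rw [h]; exact Fin.ne_of_val_ne (by simp)⟩
    · exact ⟨0, fun h' => h h'.symm⟩
  set K : ℕ := (x k').natAbs + 1 with hKdef
  have hK : (x k').natAbs < K := by omega
  set nL := Hook.longLen x k k' K with hnL
  obtain ⟨C, hC⟩ := MadrasSlade1993_cor325_lower_general (d := d + 2) (by omega)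
  have heNeg : (zdGraph (d + 2)).Adj (0 : Site (d + 2)) eNeg := by
    rw [zdGraph_adj_iff]
    exact ⟨1, Or.inr (by simp [eNeg])⟩
  set μ := connectiveConstant (d + 2) with hμ
  have hμ1 : 1 ≤ μ := one_le_connectiveConstant (d + 2)
  have hμ0 : 0 < μ := by linarith
  have hlogμ : 0 ≤ Real.log μ := Real.log_nonneg hμ1
  set c : ℝ := |C| + 2 + ((nL : ℝ) + 2) * Real.log μ + Real.log (2 * ((d : ℝ) + 2)) with hc
  have hlogd : 0 ≤ Real.log (2 * ((d : ℝ) + 2)) := Real.log_nonneg (by linarith [Nat.cast_nonneg (α := ℝ) d])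
  refine ⟨c, nL + 4, by positivity, fun N hN hpar => ?_⟩
  -- `N = nL + m + 1` with `m = 2M + 1`, `M ≥ 1`
  have hparL : nL % 2 = normOne x % 2 := Staircase.mod_two_eq_of_mem_sawFun (Hook.longWalk_mem_sawFun hkk hxk hK)
  obtain ⟨M, hM⟩ : ∃ M : ℕ, N = nL + 2 * M + 2 := ⟨(N - nL - 2) / 2, by omega⟩
  have hM1 : 1 ≤ M := by omega
  set m := 2 * M + 1 with hm
  have hNm : nL + m + 1 = N := by omega
  -- the chain `μ^{2M} e^{-C√M} ≤ c_m(0,e↓) ≤ 2(m+1) #pieces ≤ 2(m+1) c_N(0,x)`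
  have hσ1 : (x k).sign = 1 ∨ (x k).sign = -1 := by
    rcases lt_or_gt_of_ne hxk with h | h
    · exact Or.inr (Int.sign_eq_neg_one_of_neg h)
    · exact Or.inl (Int.sign_eq_one_of_pos h)
  have h1 := hC M hM1
  have h2 := HalfSpacePieces.countAt_le_card_halfSpace (m := m) heNeg (by omega) (k := k') (k' := k) hkk.symm
    (s := -1) (t := (x k).sign) (Or.inr rfl) hσ1
  have h3 := PieceInsertionZd.card_core_mul_card_pieces_le (s := -1) (Or.inr rfl) nL m
    (Staircase.len (Hook.offPlane x k k') (d + 2) + K) k' (Pi.single k (x k).sign) x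
  have hcore : 1 ≤ ((sawFun (d + 2) nL x).filter
      (PieceInsertionZd.Core nL k' (-1) (Pi.single k (x k).sign) (Staircase.len (Hook.offPlane x k k') (d + 2) + K))).card := by
    refine Finset.card_pos.2 ⟨Hook.longWalk x k k' K, Finset.mem_filter.2 ⟨?_, ?_⟩⟩
    · exact Hook.longWalk_mem_sawFun hkk hxk hK
    · exact Hook.longWalk_core hkk hxk K
  have hP : ((sawFun (d + 2) m (Pi.single k (x k).sign)).filter fun η => ∀ i ≤ m, 0 ≤ -1 * η i k') =
      PieceInsertionZd.pieces m k' (-1) (Pi.single k (x k).sign) := by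
    unfold PieceInsertionZd.pieces; rfl
  rw [hP] at h2
  set P := (PieceInsertionZd.pieces m k' (-1) (Pi.single k (x k).sign)).card with hPdef
  have h4 : P ≤ countAt (d + 2) N x := by
    rw [← hNm]
    calc P ≤ ((sawFun (d + 2) nL x).filter
          (PieceInsertionZd.Core nL k' (-1) (Pi.single k (x k).sign)
            (Staircase.len (Hook.offPlane x k k') (d + 2) + K))).card * P :=
          Nat.le_mul_of_pos_left _ hcore
      _ ≤ countAt (d + 2) (nL + m + 1) x := h3
  have hD1 : (1 : ℝ) ≤ 2 * ((d : ℝ) + 2) := by linarith [Nat.cast_nonneg (α := ℝ) d]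
  have h5 : (countAt (d + 2) m eNeg : ℝ) ≤ 2 * ((d : ℝ) + 2) * (2 * ((m : ℝ) + 1)) * countAt (d + 2) N x := by
    have : (countAt (d + 2) m eNeg : ℝ) ≤ ((4 * (d + 2) * (m + 1) * P : ℕ) : ℝ) := by exact_mod_cast h2
    refine this.trans ?_
    have hP' : (P : ℝ) ≤ countAt (d + 2) N x := by exact_mod_cast h4
    calc ((4 * (d + 2) * (m + 1) * P : ℕ) : ℝ) = (2 * ((d : ℝ) + 2) * (2 * ((m : ℝ) + 1))) * (P : ℝ) := by
          push_cast; ring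
      _ ≤ (2 * ((d : ℝ) + 2) * (2 * ((m : ℝ) + 1))) * countAt (d + 2) N x :=
          mul_le_mul_of_nonneg_left hP' (by positivity)
  have hm2M : 2 * M + 1 = m := rfl
  rw [hm2M] at h1
  -- real-analysis bookkeeping
  have hN0 : (0 : ℝ) < N := by exact_mod_cast (show 0 < N by omega)
  have hN1 : (1 : ℝ) ≤ N := by exact_mod_cast (show 1 ≤ N by omega)
  have hsN1 : 1 ≤ Real.sqrt N := by rw [Real.le_sqrt (by norm_num) hN0.le]; simpa using hN1
  have hsN0 : 0 ≤ Real.sqrt N := Real.sqrt_nonneg _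
  have hMN : Real.sqrt M ≤ Real.sqrt N := Real.sqrt_le_sqrt (by exact_mod_cast (show M ≤ N by omega))
  have hm1N : 2 * ((m : ℝ) + 1) ≤ 2 * N := by
    have : (m : ℝ) + 1 ≤ N := by exact_mod_cast (show m + 1 ≤ N by omega)
    linarith
  have hcN : (0 : ℝ) < countAt (d + 2) N x ∨ (countAt (d + 2) N x : ℝ) = 0 := by
    rcases Nat.eq_zero_or_pos (countAt (d + 2) N x) with h | h
    · exact Or.inr (by exact_mod_cast h)
    · exact Or.inl (by exact_mod_cast h)
  -- `e^{-c√N} μ^N ≤ μ^{2M} e^{-C√M} / (2(d+2) · 2N)`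
  have key : Real.exp (-(c * Real.sqrt N)) * μ ^ N ≤
      μ ^ (2 * M) * Real.exp (-(C * Real.sqrt M)) / (2 * ((d : ℝ) + 2) * (2 * N)) := by
    rw [le_div_iff₀ (by positivity)]
    have hD : 2 * ((d : ℝ) + 2) ≤ Real.exp (Real.log (2 * ((d : ℝ) + 2)) * Real.sqrt N) := by
      calc 2 * ((d : ℝ) + 2) = Real.exp (Real.log (2 * ((d : ℝ) + 2))) := (Real.exp_log (by positivity)).symm
        _ ≤ Real.exp (Real.log (2 * ((d : ℝ) + 2)) * Real.sqrt N) :=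
            Real.exp_le_exp.2 (le_mul_of_one_le_right hlogd hsN1)
    have e1 : μ ^ N = μ ^ (2 * M) * μ ^ (nL + 2) := by rw [← pow_add]; congr 1; omega
    have e2 : μ ^ (nL + 2) = Real.exp (((nL : ℝ) + 2) * Real.log μ) := by
      rw [← Real.exp_log (pow_pos hμ0 (nL + 2)), Real.log_pow]; push_cast; ring_nf
    have h6 : ((nL : ℝ) + 2) * Real.log μ ≤ ((nL : ℝ) + 2) * Real.log μ * Real.sqrt N :=
      le_mul_of_one_le_right (by positivity) hsN1
    have h7 : -(C * Real.sqrt M) ≥ -(|C| * Real.sqrt N) := by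
      have := le_abs_self C
      have : C * Real.sqrt M ≤ |C| * Real.sqrt N := by
        calc C * Real.sqrt M ≤ |C| * Real.sqrt M := mul_le_mul_of_nonneg_right (le_abs_self C) (Real.sqrt_nonneg _)
          _ ≤ |C| * Real.sqrt N := mul_le_mul_of_nonneg_left hMN (abs_nonneg C)
      linarith
    have h8 := two_mul_le_exp_two_sqrt hN0.le
    -- assemble: `e^{-c√N} μ^{2M} μ^{nL+2} (2(d+2)) (2N) ≤ μ^{2M} e^{-C√M}`
    rw [e1, e2]
    have hpos : 0 ≤ μ ^ (2 * M) := pow_nonneg hμ0.le _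
    calc Real.exp (-(c * Real.sqrt N)) * (μ ^ (2 * M) * Real.exp (((nL : ℝ) + 2) * Real.log μ)) *
          (2 * ((d : ℝ) + 2) * (2 * N))
        ≤ Real.exp (-(c * Real.sqrt N)) * (μ ^ (2 * M) * Real.exp (((nL : ℝ) + 2) * Real.log μ * Real.sqrt N)) *
            (Real.exp (Real.log (2 * ((d : ℝ) + 2)) * Real.sqrt N) * Real.exp (2 * Real.sqrt N)) := by
          gcongr
      _ = μ ^ (2 * M) * Real.exp (-(c * Real.sqrt N) + ((nL : ℝ) + 2) * Real.log μ * Real.sqrt N +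
            Real.log (2 * ((d : ℝ) + 2)) * Real.sqrt N + 2 * Real.sqrt N) := by
          rw [Real.exp_add, Real.exp_add, Real.exp_add]; ring
      _ = μ ^ (2 * M) * Real.exp (-(|C| * Real.sqrt N)) := by
          congr 2; rw [hc]; ring
      _ ≤ μ ^ (2 * M) * Real.exp (-(C * Real.sqrt M)) :=
          mul_le_mul_of_nonneg_left (Real.exp_le_exp.2 h7) hpos
  calc Real.exp (-(c * Real.sqrt N)) * μ ^ N
      ≤ μ ^ (2 * M) * Real.exp (-(C * Real.sqrt M)) / (2 * ((d : ℝ) + 2) * (2 * N)) := key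
    _ ≤ (countAt (d + 2) m eNeg : ℝ) / (2 * ((d : ℝ) + 2) * (2 * N)) := div_le_div_of_nonneg_right h1 (by positivity)
    _ ≤ 2 * ((d : ℝ) + 2) * (2 * ((m : ℝ) + 1)) * countAt (d + 2) N x / (2 * ((d : ℝ) + 2) * (2 * N)) :=
        div_le_div_of_nonneg_right h5 (by positivity)
    _ ≤ 2 * ((d : ℝ) + 2) * (2 * N) * countAt (d + 2) N x / (2 * ((d : ℝ) + 2) * (2 * N)) := by
        apply div_le_div_of_nonneg_right _ (by positivity)
        apply mul_le_mul_of_nonneg_right _ (Nat.cast_nonneg _)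
        exact mul_le_mul_of_nonneg_left hm1N (by positivity)
    _ = countAt (d + 2) N x := by field_simp


/-- `c_N(0,x) ≤ c_N`. [cite: MadrasSlade1993, §1.1] -/
private theorem countAt_le_count' (n : ℕ) (x : Site (d + 2)) : countAt (d + 2) n x ≤ count (d + 2) n := by
  classical
  rw [← card_sawFun, ← card_saws]
  exact Finset.card_le_card fun ω hω => (mem_sawFun_iff_mem_saws.1 hω).1

/-- **Madras–Slade Corollary 3.2.6, eq. (3.2.10), for a fixed endpoint, every dimension**: for `x ≠ 0` in `ℤ^d` (`d ≥ 2`),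
`lim c_N(0,x)^{1/N} = μ` as `N → ∞` through the parity class of `‖x‖₁` (here `N = 2M + (‖x‖₁ mod 2)`, `M → ∞`).
[cite: MadrasSlade1993, Corollary 3.2.6, eq. (3.2.10) (p. 68)] -/
theorem _root_.Literature.Probability.RandomPlanarGeometry.SAW.Zd.MadrasSlade1993_cor326_allDim (x : Site (d + 2)) (hx : x ≠ 0) :
    Tendsto (fun M : ℕ => ((countAt (d + 2) (2 * M + normOne x % 2) x : ℝ)) ^ (1 / ((2 * M + normOne x % 2 : ℕ) : ℝ)))
      atTop (𝓝 (connectiveConstant (d + 2))) := by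
  obtain ⟨c, N₀, hc, henv⟩ := exists_exp_mul_pow_le_countAt x hx
  set μ := connectiveConstant (d + 2) with hμ
  have hμ0 : 0 < μ := connectiveConstant_pos (d + 2)
  set r := normOne x % 2 with hr
  -- the subsequence `N(M) = 2M + r → ∞`
  have hN : Tendsto (fun M : ℕ => 2 * M + r) atTop atTop :=
    tendsto_atTop_mono (fun M => by simp only [id]; omega) tendsto_id
  -- upper bound `c_N(0,x)^{1/N} ≤ c_N^{1/N} → μ`
  have hup : Tendsto (fun M : ℕ => ((count (d + 2) (2 * M + r) : ℝ)) ^ (1 / ((2 * M + r : ℕ) : ℝ))) atTop (𝓝 μ) :=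
    (tendsto_count_rpow (d + 2)).comp hN
  -- lower bound `(e^{-c√N} μ^N)^{1/N} = μ e^{-c/√N} → μ`
  have hlow : Tendsto (fun M : ℕ => μ * Real.exp (-(c / Real.sqrt ((2 * M + r : ℕ) : ℝ)))) atTop (𝓝 μ) := by
    have h1 : Tendsto (fun M : ℕ => c / Real.sqrt ((2 * M + r : ℕ) : ℝ)) atTop (𝓝 0) := by
      have hs : Tendsto (fun M : ℕ => Real.sqrt ((2 * M + r : ℕ) : ℝ)) atTop atTop :=
        Real.tendsto_sqrt_atTop.comp (tendsto_natCast_atTop_atTop.comp hN)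
      exact hs.const_div_atTop c
    have h2 : Tendsto (fun M : ℕ => Real.exp (-(c / Real.sqrt ((2 * M + r : ℕ) : ℝ)))) atTop (𝓝 1) := by
      have h1' : Tendsto (fun M : ℕ => -(c / Real.sqrt ((2 * M + r : ℕ) : ℝ))) atTop (𝓝 0) := by
        simpa using h1.neg
      have := (Real.continuous_exp.tendsto 0).comp h1'
      rw [Real.exp_zero] at this
      exact this
    simpa using h2.const_mul μ
  refine tendsto_of_tendsto_of_tendsto_of_le_of_le' hlow hup ?_ ?_
  · filter_upwards [eventually_ge_atTop (N₀ + 1)] with M hM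
    have hNpos : 0 < 2 * M + r := by omega
    have hNr : (0 : ℝ) < ((2 * M + r : ℕ) : ℝ) := by exact_mod_cast hNpos
    have hpar : (2 * M + r) % 2 = normOne x % 2 := by rw [hr]; omega
    have h := henv (2 * M + r) (by omega) hpar
    have hpos : 0 ≤ Real.exp (-(c * Real.sqrt ((2 * M + r : ℕ) : ℝ))) * μ ^ (2 * M + r) := by positivity
    calc μ * Real.exp (-(c / Real.sqrt ((2 * M + r : ℕ) : ℝ)))
        = (Real.exp (-(c * Real.sqrt ((2 * M + r : ℕ) : ℝ))) * μ ^ (2 * M + r)) ^ (1 / ((2 * M + r : ℕ) : ℝ)) := by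
          rw [Real.mul_rpow (by positivity) (by positivity), one_div,
            Real.pow_rpow_inv_natCast hμ0.le hNpos.ne', ← Real.exp_mul, mul_comm μ]
          congr 2
          have hs : Real.sqrt ((2 * M + r : ℕ) : ℝ) ≠ 0 := (Real.sqrt_pos.2 hNr).ne'
          have hs2 : Real.sqrt ((2 * M + r : ℕ) : ℝ) * Real.sqrt ((2 * M + r : ℕ) : ℝ) = ((2 * M + r : ℕ) : ℝ) :=
            Real.mul_self_sqrt hNr.le
          field_simp
          nlinarith [hs2]
      _ ≤ ((countAt (d + 2) (2 * M + r) x : ℝ)) ^ (1 / ((2 * M + r : ℕ) : ℝ)) :=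
          Real.rpow_le_rpow hpos h (by positivity)
  · filter_upwards [eventually_ge_atTop 1] with M hM
    exact Real.rpow_le_rpow (Nat.cast_nonneg _) (by exact_mod_cast countAt_le_count' _ x) (by positivity)

end EndpointEnvelopeZd

end Literature.Probability.RandomPlanarGeometry.SAW.Zd
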